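/-
Copyright (c) 2026 the pub-hodgecm-mathlib formalisation cell (harness21).  Prover seat hodgecm-mathlib-K2E3-p03 (g8), HCML Track B «K2-LIT» ∕ h413
(`stmt-HodgeConjecture-24833`), leaf (nsc-S-A′), case bricks C1″∕C1′: the (T)-programme — «NO `Y` ALONE» (C1″, NYA) ⟺ «NO `A` ALONE» (C1′, NAA) along `θ = gkAutomorphism`.
2026-09-04.
-/
import Summits.HodgeConjecture.HodgeConjecture.Theorems.K2E3GL3IrrepTransport             -- ★ F6 (this lineage, g7): `exists_gkTwist`, `finrank_weightSpace_gkTwist_tch ∕ _gkTwist_eq`, fd ∕ admissibility transfer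
import Summits.HodgeConjecture.HodgeConjecture.Theorems.K2E3GL3StandardModuleEmbedding     -- ★ STD-EMB (this lineage, g6): `ker_inv_eq_ker`
import HarnessLib

/-!
# Crux `H413` — leaf (nsc-S-A′), bricks C1″∕C1′: NYA(η) ⟺ NAA(η⁻¹) — one proof for the pair of «no weight alone» letters

Cell `hodgecm-mathlib`, Track B; THEOREMS ONLY; count-neutral helper (`--supports stmt-HodgeConjecture-24833 --as helper`).  Letters: `a = ην½⁻¹`, `aν = ην½`,
`Y(η) = tch(aν, a, aν)` (C1″, ★ IRR″-a), `A(η) = tch(a, aν, a)` (C1′, K2E3-p17 census §0).  «NO `v` ALONE» for a letter vector `v` is the statement (= the `hNYA` binder of ★ p861011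
`K2E3GL3OneLinkNestedHigh.sAprimeC1high_of`, hosted as socket (C1″-NYA) `sig_K2E3GL3NestedHighNoWeightYAlone`, with `Y ↦ tch v`): no admissible irreducible `r` of `GL₃(F)` with
finite-dimensional `r_B` has `mult r (tch v) = 1` and `mult r ζ = 0` for every other weight function `ζ`.
* §1 letters: `(η⁻¹ν½∓)⁻¹ = ην½±`, so the reversed-inverted vectors are `A(η⁻¹) ↦ Y(η)`, `Y(η) ↦ A(η⁻¹)`, `Y(η⁻¹) ↦ A(η)`, `A(η) ↦ Y(η⁻¹)`.
* §2 **`noWeightAlone_transport`** — for letter vectors `θv, θv′` that are reversed inverses of each other, «NO `θv′` ALONE» ⇒ «NO `θv` ALONE»: twist a witness `r` by `θ`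
  (★ F6 `exists_gkTwist`); `mult_{r∘θ}(tch θv′) = mult_r(tch θv) = 1` (★ F6 `finrank_weightSpace_gkTwist_tch`), and every other weight of `r∘θ` vanishes because
  `ζ ↦ ζ ∘ θ_T` is an involution on weight functions (★ part 1 `leviAut_leviAut`, `tch_comp_leviAut_gkAutomorphism`); admissibility and finite-dimensionality transfer (★ F6).
* §3 **`noWeightYAlone_of_noWeightAAlone`** (NYA(η) ⟸ NAA(η⁻¹)), **`noWeightAAlone_of_noWeightYAlone`** (NAA(η) ⟸ NYA(η⁻¹)), and the `∀ η`-closed forms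
  **`forall_noWeightYAlone_of_forall_noWeightAAlone`** ∕ **`forall_noWeightAAlone_of_forall_noWeightYAlone`** (★ `ker_inv_eq_ker`): whichever of NAA (K2E3-p17 (g9), Q-side,
  Frobenius into `D_low`) ∕ NYA (Q′-side, Frobenius into `D‴`) lands first pays the other BY NAME.
[BernsteinZelevinsky1976, §2.21–2.25]; [Zelevinsky1980, §1.1, Ex. 3.2, Thm. 6.1].

HONEST LABEL: HC_CM is proved only modulo the 7 printed citations (2 remaining named inputs: hLiu418 = stmt-HodgeConjecture-24832, h413 =
stmt-HodgeConjecture-24833) until rung 0 closes; count-neutral helper; unconditional equivalence of two OPEN letters (neither is assumed).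

## References
* [BernsteinZelevinsky1976] I. N. Bernstein, A. V. Zelevinsky, *Representations of the group GL(n,F) where F is a non-archimedean local field*, Russian Math. Surveys 31 (1976), §2.21–2.25.
* [Zelevinsky1980] A. V. Zelevinsky, *Induced representations of reductive p-adic groups II*, Ann. Sci. ÉNS 13 (1980), §1.1, Ex. 3.2, Thm. 6.1.
-/

set_option autoImplicit false
-- the mandated namespace repeats `HodgeConjecture.HodgeConjecture`, as in every `Theorems/*.lean` of this sub-problem
set_option linter.dupNamespace false

noncomputable section

open Module Representation Function Literature.NumberTheory.Automorphic Literature.NumberTheory.Automorphic.Zelevinsky1980 Literature.NumberTheory.GaloisRepresentations.IsNonarchimedeanLocalField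
open Literature.NumberTheory.GaloisRepresentations Literature.RepresentationTheory.FiniteGroups
open scoped MatrixGroups NNReal
open Summit.HodgeConjecture.HodgeConjecture.Cruxes.H413.K2E3GL3OuterAutomorphismInduction (gkAutomorphism_gkAutomorphism)
open Summit.HodgeConjecture.HodgeConjecture.Cruxes.H413.K2E3JacquetWeightTransport (leviAut_leviAut tch_comp_leviAut_gkAutomorphism gkAutomorphism_mem_unipotentRadicalP_borel)
open Summit.HodgeConjecture.HodgeConjecture.Cruxes.H413.K2E3GL3IrrepTransport (exists_gkTwist finrank_weightSpace_gkTwist_tch finrank_weightSpace_gkTwist_eq finiteDimensional_jacquet_gkTwist_iff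
  isAdmissible_gkTwist_iff)
open Summit.HodgeConjecture.HodgeConjecture.Cruxes.H413.K2E3GL3StandardModuleEmbedding (ker_inv_eq_ker)
open Summit.HodgeConjecture.HodgeConjecture.Cruxes.H413

namespace Summit.HodgeConjecture.HodgeConjecture.Cruxes.H413.K2E3GL3NoWeightAloneTransport

variable {F : Type} [Field F] [ValuativeRel F] [TopologicalSpace F] [IsNonarchimedeanLocalField F] (η : Fˣ →* ℂˣ)

/-! ## §1 Letters: reversed inverses of `A(η⁻¹)`, `Y(η)`, `Y(η⁻¹)`, `A(η)` -/

section Letters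

/-- `(x⁻¹ν½⁻¹)⁻¹ = xν½` (pointwise). [folklore] -/
theorem inv_letter_inv_mul_inv (x : Fˣ →* ℂˣ) : (x⁻¹ * ((unramifiedTwist F (1 / 2) : QuasiChar F).toMonoidHom)⁻¹)⁻¹ = x * ((unramifiedTwist F (1 / 2) : QuasiChar F).toMonoidHom) :=
  MonoidHom.ext fun t => by
    simp only [MonoidHom.inv_apply, MonoidHom.mul_apply, mul_inv_rev, inv_inv]
    exact mul_comm _ _

/-- `(x⁻¹ν½)⁻¹ = xν½⁻¹` (pointwise). [folklore] -/
theorem inv_letter_inv_mul (x : Fˣ →* ℂˣ) : (x⁻¹ * ((unramifiedTwist F (1 / 2) : QuasiChar F).toMonoidHom))⁻¹ = x * ((unramifiedTwist F (1 / 2) : QuasiChar F).toMonoidHom)⁻¹ :=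
  MonoidHom.ext fun t => by
    simp only [MonoidHom.inv_apply, MonoidHom.mul_apply, mul_inv_rev, inv_inv]
    exact mul_comm _ _

/-- `(xν½⁻¹)⁻¹ = x⁻¹ν½` (pointwise). [folklore] -/
theorem inv_letter_mul_inv (x : Fˣ →* ℂˣ) : (x * ((unramifiedTwist F (1 / 2) : QuasiChar F).toMonoidHom)⁻¹)⁻¹ = x⁻¹ * ((unramifiedTwist F (1 / 2) : QuasiChar F).toMonoidHom) :=
  MonoidHom.ext fun t => by
    simp only [MonoidHom.inv_apply, MonoidHom.mul_apply, mul_inv_rev, inv_inv]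
    exact mul_comm _ _

/-- `(xν½)⁻¹ = x⁻¹ν½⁻¹` (pointwise). [folklore] -/
theorem inv_letter_mul (x : Fˣ →* ℂˣ) : (x * ((unramifiedTwist F (1 / 2) : QuasiChar F).toMonoidHom))⁻¹ = x⁻¹ * ((unramifiedTwist F (1 / 2) : QuasiChar F).toMonoidHom)⁻¹ :=
  MonoidHom.ext fun t => by
    simp only [MonoidHom.inv_apply, MonoidHom.mul_apply, mul_inv_rev]
    exact mul_comm _ _

/-- The reversed inverse of `A(η⁻¹) = (η⁻¹ν½⁻¹, η⁻¹ν½, η⁻¹ν½⁻¹)` is `Y(η) = (ην½, ην½⁻¹, ην½)`. [folklore] -/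
theorem revinv_A_inv : (![((![(η⁻¹ * ((unramifiedTwist F (1 / 2) : QuasiChar F).toMonoidHom)⁻¹), (η⁻¹ * ((unramifiedTwist F (1 / 2) : QuasiChar F).toMonoidHom)), (η⁻¹ * ((unramifiedTwist F (1 / 2) : QuasiChar F).toMonoidHom)⁻¹)] : Fin 3 → (Fˣ →* ℂˣ)) 2)⁻¹, ((![(η⁻¹ * ((unramifiedTwist F (1 / 2) : QuasiChar F).toMonoidHom)⁻¹), (η⁻¹ * ((unramifiedTwist F (1 / 2) : QuasiChar F).toMonoidHom)), (η⁻¹ * ((unramifiedTwist F (1 / 2) : QuasiChar F).toMonoidHom)⁻¹)] : Fin 3 → (Fˣ →* ℂˣ)) 1)⁻¹, ((![(η⁻¹ * ((unramifiedTwist F (1 / 2) : QuasiChar F).toMonoidHom)⁻¹), (η⁻¹ * ((unramifiedTwist F (1 / 2) : QuasiChar F).toMonoidHom)), (η⁻¹ * ((unramifiedTwist F (1 / 2) : QuasiChar F).toMonoidHom)⁻¹)] : Fin 3 → (Fˣ →* ℂˣ)) 0)⁻¹] : Fin 3 → (Fˣ →* ℂˣ)) = (![(η * ((unramifiedTwist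 F (1 / 2) : QuasiChar F).toMonoidHom)), (η * ((unramifiedTwist F (1 / 2) : QuasiChar F).toMonoidHom)⁻¹), (η * ((unramifiedTwist F (1 / 2) : QuasiChar F).toMonoidHom))] : Fin 3 → (Fˣ →* ℂˣ)) := by
  simp only [Matrix.cons_val_zero, Matrix.cons_val_one, Matrix.head_cons, Matrix.cons_val_two, Matrix.tail_cons, inv_letter_inv_mul_inv, inv_letter_inv_mul]

/-- The reversed inverse of `Y(η)` is `A(η⁻¹)`. [folklore] -/
theorem revinv_Y : (![((![(η * ((unramifiedTwist F (1 / 2) : QuasiChar F).toMonoidHom)), (η * ((unramifiedTwist F (1 / 2) : QuasiChar F).toMonoidHom)⁻¹), (η * ((unramifiedTwist F (1 / 2) : QuasiChar F).toMonoidHom))] : Fin 3 → (Fˣ →* ℂˣ)) 2)⁻¹, ((![(η * ((unramifiedTwist F (1 / 2) : QuasiChar F).toMonoidHom)), (η * ((unramifiedTwist F (1 / 2) : QuasiChar F).toMonoidHom)⁻¹), (η * ((unramifiedTwist F (1 / 2) : QuasiChar F).toMonoidHom))] : Fin 3 → (Fˣ →* ℂˣ)) 1)⁻¹, ((![(η *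 ((unramifiedTwist F (1 / 2) : QuasiChar F).toMonoidHom)), (η * ((unramifiedTwist F (1 / 2) : QuasiChar F).toMonoidHom)⁻¹), (η * ((unramifiedTwist F (1 / 2) : QuasiChar F).toMonoidHom))] : Fin 3 → (Fˣ →* ℂˣ)) 0)⁻¹] : Fin 3 → (Fˣ →* ℂˣ)) = (![(η⁻¹ * ((unramifiedTwist F (1 / 2) : QuasiChar F).toMonoidHom)⁻¹), (η⁻¹ * ((unramifiedTwist F (1 / 2) : QuasiChar F).toMonoidHom)), (η⁻¹ * ((unramifiedTwist F (1 / 2) : QuasiChar F).toMonoidHom)⁻¹)] : Fin 3 → (Fˣ →* ℂˣ)) := by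
  simp only [Matrix.cons_val_zero, Matrix.cons_val_one, Matrix.head_cons, Matrix.cons_val_two, Matrix.tail_cons, inv_letter_mul_inv, inv_letter_mul]

/-- The reversed inverse of `Y(η⁻¹)` is `A(η)`. [folklore] -/
theorem revinv_Y_inv : (![((![(η⁻¹ * ((unramifiedTwist F (1 / 2) : QuasiChar F).toMonoidHom)), (η⁻¹ * ((unramifiedTwist F (1 / 2) : QuasiChar F).toMonoidHom)⁻¹), (η⁻¹ * ((unramifiedTwist F (1 / 2) : QuasiChar F).toMonoidHom))] : Fin 3 → (Fˣ →* ℂˣ)) 2)⁻¹, ((![(η⁻¹ * ((unramifiedTwist F (1 / 2) : QuasiChar F).toMonoidHom)), (η⁻¹ * ((unramifiedTwist F (1 / 2) : QuasiChar F).toMonoidHom)⁻¹), (η⁻¹ * ((unramifiedTwist F (1 / 2) : QuasiChar F).toMonoidHom))] : Fin 3 → (Fˣ →* ℂˣ)) 1)⁻¹, ((![(η⁻¹ * ((unramifiedTwist F (1 / 2) : QuasiChar F).toMonoidHom)), (η⁻¹ * ((unramifiedTwist F (1 / 2) : QuasiChar F).toMonoidHom)⁻¹), (η⁻¹ * ((unramifiedTwist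 F (1 / 2) : QuasiChar F).toMonoidHom))] : Fin 3 → (Fˣ →* ℂˣ)) 0)⁻¹] : Fin 3 → (Fˣ →* ℂˣ)) = (![(η * ((unramifiedTwist F (1 / 2) : QuasiChar F).toMonoidHom)⁻¹), (η * ((unramifiedTwist F (1 / 2) : QuasiChar F).toMonoidHom)), (η * ((unramifiedTwist F (1 / 2) : QuasiChar F).toMonoidHom)⁻¹)] : Fin 3 → (Fˣ →* ℂˣ)) := by
  simp only [Matrix.cons_val_zero, Matrix.cons_val_one, Matrix.head_cons, Matrix.cons_val_two, Matrix.tail_cons, inv_letter_inv_mul_inv, inv_letter_inv_mul]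

/-- The reversed inverse of `A(η)` is `Y(η⁻¹)`. [folklore] -/
theorem revinv_A : (![((![(η * ((unramifiedTwist F (1 / 2) : QuasiChar F).toMonoidHom)⁻¹), (η * ((unramifiedTwist F (1 / 2) : QuasiChar F).toMonoidHom)), (η * ((unramifiedTwist F (1 / 2) : QuasiChar F).toMonoidHom)⁻¹)] : Fin 3 → (Fˣ →* ℂˣ)) 2)⁻¹, ((![(η * ((unramifiedTwist F (1 / 2) : QuasiChar F).toMonoidHom)⁻¹), (η * ((unramifiedTwist F (1 / 2) : QuasiChar F).toMonoidHom)), (η * ((unramifiedTwist F (1 / 2) : QuasiChar F).toMonoidHom)⁻¹)] : Fin 3 → (Fˣ →* ℂˣ)) 1)⁻¹, ((![(η * ((unramifiedTwist F (1 / 2) : QuasiChar F).toMonoidHom)⁻¹), (η * ((unramifiedTwist F (1 / 2) : QuasiChar F).toMonoidHom)), (η * ((unramifiedTwist F (1 / 2) : QuasiChar F).toMonoidHom)⁻¹)] : Fin 3 → (Fˣ →* ℂˣ)) 0)⁻¹] : Fin 3 → (Fˣ →* ℂˣ)) = (![(η⁻¹ * ((unramifiedTwist F (1 / 2) : QuasiChar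 F).toMonoidHom)), (η⁻¹ * ((unramifiedTwist F (1 / 2) : QuasiChar F).toMonoidHom)⁻¹), (η⁻¹ * ((unramifiedTwist F (1 / 2) : QuasiChar F).toMonoidHom))] : Fin 3 → (Fˣ →* ℂˣ)) := by
  simp only [Matrix.cons_val_zero, Matrix.cons_val_one, Matrix.head_cons, Matrix.cons_val_two, Matrix.tail_cons, inv_letter_mul_inv, inv_letter_mul]

end Letters

/-! ## §2 The transport of «no weight alone» along `θ` -/

/-- `θ_T` is an involution of the diagonal torus (★ part 1 `leviAut_leviAut` at `θ = gkAutomorphism`, `c = id`). [cite: Zelevinsky1980, §1.1] -/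
theorem thetaT_thetaT (m : (Π a : Fin 3, GL {i : Fin 3 // (id : Fin 3 → Fin 3) i = a} F)) : (leviProjection F (id : Fin 3 → Fin 3) ⟨gkAutomorphism (blockDiagonalGL F (id : Fin 3 → Fin 3) (leviProjection F (id : Fin 3 → Fin 3) ⟨gkAutomorphism (blockDiagonalGL F (id : Fin 3 → Fin 3) m), (K2E3GL3WeakCellLemmaTransport.gkAutomorphism_mem_borel_iff F _).2 (blockDiagonalGL_mem (id : Fin 3 → Fin 3) m)⟩)), (K2E3GL3WeakCellLemmaTransport.gkAutomorphism_mem_borel_iff F _).2 (blockDiagonalGL_mem (id : Fin 3 → Fin 3) (leviProjection F (id : Fin 3 → Fin 3) ⟨gkAutomorphism (blockDiagonalGL F (id : Fin 3 → Fin 3) m), (K2E3GL3WeakCellLemmaTransport.gkAutomorphism_mem_borel_iff F _).2 (blockDiagonalGL_mem (id : Fin 3 → Fin 3) m)⟩))⟩) = m :=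
  leviAut_leviAut F (id : Fin 3 → Fin 3) (gkAutomorphism : GL (Fin 3) F ≃ₜ* GL (Fin 3) F) (gkAutomorphism_gkAutomorphism F)
    (K2E3GL3WeakCellLemmaTransport.gkAutomorphism_mem_borel_iff F) gkAutomorphism_mem_unipotentRadicalP_borel m

set_option maxHeartbeats 800000 in  -- large weight terms: cumulative elaboration budget (as in ★ F6)
/-- **TRANSPORT OF «NO WEIGHT ALONE»**: if `θv` and `θv′` are reversed inverses of each other (`(θv′₂⁻¹, θv′₁⁻¹, θv′₀⁻¹) = θv` and conversely), then «NO `θv′` ALONE» implies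
«NO `θv` ALONE»: a witness `r` (admissible, `E(r) = {tch θv ¹}`) twists to `r′ = r ∘ θ` (★ F6 `exists_gkTwist`), admissible with finite-dimensional `r_B` (★ F6), with
`mult_{r′}(tch θv′) = mult_r(tch θv) = 1` (★ F6 `finrank_weightSpace_gkTwist_tch`) and `mult_{r′} ζ = mult_r (ζ ∘ θ_T) = 0` for `ζ ≠ tch θv′` — since `ζ ∘ θ_T = tch θv` would give
`ζ = (tch θv) ∘ θ_T = tch θv′` (`θ_T` an involution, ★ part 1 `tch_comp_leviAut_gkAutomorphism`). [cite: BernsteinZelevinsky1976, §2.23] [cite: Zelevinsky1980, §1.1] -/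
theorem noWeightAlone_transport (θv θv' : Fin 3 → (Fˣ →* ℂˣ)) (hrev : (![(θv' 2)⁻¹, (θv' 1)⁻¹, (θv' 0)⁻¹] : Fin 3 → (Fˣ →* ℂˣ)) = θv) (hrev' : (![(θv 2)⁻¹, (θv 1)⁻¹, (θv 0)⁻¹] : Fin 3 → (Fˣ →* ℂˣ)) = θv')
    (hno : ∀ (r : SmoothIrrep (GL (Fin 3) F)), r.ρ.IsAdmissible → ∀ [FiniteDimensional ℂ (restrictUnipotentGL F (id : Fin 3 → Fin 3) r.ρ).Coinvariants],
      finrank ℂ ↥(⨅ m, Module.End.maxGenEigenspace (Representation.normalizedJacquetGL F (id : Fin 3 → Fin 3) r.ρ m) (((∏ a : Fin 3, (θv' a).comp (Matrix.GeneralLinearGroup.det.comp (Pi.evalMonoidHom (fun a : Fin 3 => GL {i : Fin 3 // (id : Fin 3 → Fin 3) i = a} F) a))) m : ℂˣ) : ℂ)) = 1 →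
      (∀ ζ : (Π a : Fin 3, GL {i : Fin 3 // (id : Fin 3 → Fin 3) i = a} F) → ℂ, ζ ≠ (fun m : (Π a : Fin 3, GL {i : Fin 3 // (id : Fin 3 → Fin 3) i = a} F) => (((∏ a : Fin 3, (θv' a).comp (Matrix.GeneralLinearGroup.det.comp (Pi.evalMonoidHom (fun a : Fin 3 => GL {i : Fin 3 // (id : Fin 3 → Fin 3) i = a} F) a))) m : ℂˣ) : ℂ)) → finrank ℂ ↥(⨅ m, Module.End.maxGenEigenspace (Representation.normalizedJacquetGL F (id : Fin 3 → Fin 3) r.ρ m) (ζ m)) = 0) → False) :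
    ∀ (r : SmoothIrrep (GL (Fin 3) F)), r.ρ.IsAdmissible → ∀ [FiniteDimensional ℂ (restrictUnipotentGL F (id : Fin 3 → Fin 3) r.ρ).Coinvariants],
      finrank ℂ ↥(⨅ m, Module.End.maxGenEigenspace (Representation.normalizedJacquetGL F (id : Fin 3 → Fin 3) r.ρ m) (((∏ a : Fin 3, (θv a).comp (Matrix.GeneralLinearGroup.det.comp (Pi.evalMonoidHom (fun a : Fin 3 => GL {i : Fin 3 // (id : Fin 3 → Fin 3) i = a} F) a))) m : ℂˣ) : ℂ)) = 1 →
      (∀ ζ : (Π a : Fin 3, GL {i : Fin 3 // (id : Fin 3 → Fin 3) i = a} F) → ℂ, ζ ≠ (fun m : (Π a : Fin 3, GL {i : Fin 3 // (id : Fin 3 → Fin 3) i = a} F) => (((∏ a : Fin 3, (θv a).comp (Matrix.GeneralLinearGroup.det.comp (Pi.evalMonoidHom (fun a : Fin 3 => GL {i : Fin 3 // (id : Fin 3 → Fin 3) i = a} F) a))) m : ℂˣ) : ℂ)) → finrank ℂ ↥(⨅ m, Module.End.maxGenEigenspace (Representation.normalizedJacquetGL F (id : Fin 3 → Fin 3)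 r.ρ m) (ζ m)) = 0) → False := by
  intro r hadm hfd h1 h0
  have hex := exists_gkTwist r
  obtain ⟨r', Φ, hΦ⟩ := hex
  haveI : FiniteDimensional ℂ (restrictUnipotentGL F (id : Fin 3 → Fin 3) r'.ρ).Coinvariants := (finiteDimensional_jacquet_gkTwist_iff Φ hΦ).2 hfd
  have hadm' : r'.ρ.IsAdmissible := (isAdmissible_gkTwist_iff Φ hΦ).2 hadm
  have h1' : finrank ℂ ↥(⨅ m, Module.End.maxGenEigenspace (Representation.normalizedJacquetGL F (id : Fin 3 → Fin 3) r'.ρ m) (((∏ a : Fin 3, (θv' a).comp (Matrix.GeneralLinearGroup.det.comp (Pi.evalMonoidHom (fun a : Fin 3 => GL {i : Fin 3 // (id : Fin 3 → Fin 3) i = a} F) a))) m : ℂˣ) : ℂ)) = 1 := by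
    rw [finrank_weightSpace_gkTwist_tch Φ hΦ θv', hrev]
    exact h1
  refine hno r' hadm' h1' fun ζ hζ => ?_
  rw [finrank_weightSpace_gkTwist_eq Φ hΦ ζ]
  refine h0 (fun m : (Π a : Fin 3, GL {i : Fin 3 // (id : Fin 3 → Fin 3) i = a} F) => ζ (leviProjection F (id : Fin 3 → Fin 3) ⟨gkAutomorphism (blockDiagonalGL F (id : Fin 3 → Fin 3) m), (K2E3GL3WeakCellLemmaTransport.gkAutomorphism_mem_borel_iff F _).2 (blockDiagonalGL_mem (id : Fin 3 → Fin 3) m)⟩)) fun heq => hζ (funext fun m => ?_)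
  have h2 := congrFun heq (leviProjection F (id : Fin 3 → Fin 3) ⟨gkAutomorphism (blockDiagonalGL F (id : Fin 3 → Fin 3) m), (K2E3GL3WeakCellLemmaTransport.gkAutomorphism_mem_borel_iff F _).2 (blockDiagonalGL_mem (id : Fin 3 → Fin 3) m)⟩)
  have h3 := congrFun (tch_comp_leviAut_gkAutomorphism (F := F) θv) m
  beta_reduce at h2 h3
  rw [thetaT_thetaT] at h2
  rw [h2, h3, hrev']

/-! ## §3 NYA ⟺ NAA -/

/-- **NYA(η) ⟸ NAA(η⁻¹)**: «no `A(η⁻¹) = (η⁻¹ν½⁻¹, η⁻¹ν½, η⁻¹ν½⁻¹)` alone» ⇒ «no `Y(η) = (ην½, ην½⁻¹, ην½)` alone» (§2 with §1 `revinv_A_inv`, `revinv_Y`).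
[cite: BernsteinZelevinsky1976, §2.23] [cite: Zelevinsky1980, §1.1, Ex. 3.2] -/
theorem noWeightYAlone_of_noWeightAAlone (hNAA : ∀ (r : SmoothIrrep (GL (Fin 3) F)), r.ρ.IsAdmissible → ∀ [FiniteDimensional ℂ (restrictUnipotentGL F (id : Fin 3 → Fin 3) r.ρ).Coinvariants],
      finrank ℂ ↥(⨅ m, Module.End.maxGenEigenspace (Representation.normalizedJacquetGL F (id : Fin 3 → Fin 3) r.ρ m) (((∏ a : Fin 3, ((![(η⁻¹ * ((unramifiedTwist F (1 / 2) : QuasiChar F).toMonoidHom)⁻¹), (η⁻¹ * ((unramifiedTwist F (1 / 2) : QuasiChar F).toMonoidHom)), (η⁻¹ * ((unramifiedTwist F (1 / 2) : QuasiChar F).toMonoidHom)⁻¹)] : Fin 3 → (Fˣ →* ℂˣ)) a).comp (Matrix.GeneralLinearGroup.det.comp (Pi.evalMonoidHom (fun a : Fin 3 => GL {i : Fin 3 // (id : Fin 3 → Fin 3) i = a} F) a))) m : ℂˣ) : ℂ)) = 1 →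
      (∀ ζ : (Π a : Fin 3, GL {i : Fin 3 // (id : Fin 3 → Fin 3) i = a} F) → ℂ, ζ ≠ (fun m : (Π a : Fin 3, GL {i : Fin 3 // (id : Fin 3 → Fin 3) i = a} F) => (((∏ a : Fin 3, ((![(η⁻¹ * ((unramifiedTwist F (1 / 2) : QuasiChar F).toMonoidHom)⁻¹), (η⁻¹ * ((unramifiedTwist F (1 / 2) : QuasiChar F).toMonoidHom)), (η⁻¹ * ((unramifiedTwist F (1 / 2) : QuasiChar F).toMonoidHom)⁻¹)] : Fin 3 → (Fˣ →* ℂˣ)) a).comp (Matrix.GeneralLinearGroup.det.comp (Pi.evalMonoidHom (fun a : Fin 3 => GL {i : Fin 3 // (id : Fin 3 → Fin 3) i = a} F) a))) m : ℂˣ) : ℂ)) → finrank ℂ ↥(⨅ m, Module.End.maxGenEigenspace (Representation.normalizedJacquetGL F (id : Fin 3 → Fin 3) r.ρ m) (ζ m)) = 0) → False) :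
    ∀ (r : SmoothIrrep (GL (Fin 3) F)), r.ρ.IsAdmissible → ∀ [FiniteDimensional ℂ (restrictUnipotentGL F (id : Fin 3 → Fin 3) r.ρ).Coinvariants],
      finrank ℂ ↥(⨅ m, Module.End.maxGenEigenspace (Representation.normalizedJacquetGL F (id : Fin 3 → Fin 3) r.ρ m) (((∏ a : Fin 3, ((![(η * ((unramifiedTwist F (1 / 2) : QuasiChar F).toMonoidHom)), (η * ((unramifiedTwist F (1 / 2) : QuasiChar F).toMonoidHom)⁻¹), (η * ((unramifiedTwist F (1 / 2) : QuasiChar F).toMonoidHom))] : Fin 3 → (Fˣ →* ℂˣ)) a).comp (Matrix.GeneralLinearGroup.det.comp (Pi.evalMonoidHom (fun a : Fin 3 => GL {i : Fin 3 // (id : Fin 3 → Fin 3) i = a} F) a))) m : ℂˣ) : ℂ)) = 1 →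
      (∀ ζ : (Π a : Fin 3, GL {i : Fin 3 // (id : Fin 3 → Fin 3) i = a} F) → ℂ, ζ ≠ (fun m : (Π a : Fin 3, GL {i : Fin 3 // (id : Fin 3 → Fin 3) i = a} F) => (((∏ a : Fin 3, ((![(η * ((unramifiedTwist F (1 / 2) : QuasiChar F).toMonoidHom)), (η * ((unramifiedTwist F (1 / 2) : QuasiChar F).toMonoidHom)⁻¹), (η * ((unramifiedTwist F (1 / 2) : QuasiChar F).toMonoidHom))] : Fin 3 → (Fˣ →* ℂˣ)) a).comp (Matrix.GeneralLinearGroup.det.comp (Pi.evalMonoidHom (fun a : Fin 3 => GL {i : Fin 3 // (id : Fin 3 → Fin 3) i = a} F) a))) m : ℂˣ) : ℂ)) → finrank ℂ ↥(⨅ m, Module.End.maxGenEigenspace (Representation.normalizedJacquetGL F (id : Fin 3 → Fin 3) r.ρ m) (ζ m)) = 0) → False :=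
  noWeightAlone_transport (![(η * ((unramifiedTwist F (1 / 2) : QuasiChar F).toMonoidHom)), (η * ((unramifiedTwist F (1 / 2) : QuasiChar F).toMonoidHom)⁻¹), (η * ((unramifiedTwist F (1 / 2) : QuasiChar F).toMonoidHom))] : Fin 3 → (Fˣ →* ℂˣ)) (![(η⁻¹ * ((unramifiedTwist F (1 / 2) : QuasiChar F).toMonoidHom)⁻¹), (η⁻¹ * ((unramifiedTwist F (1 / 2) : QuasiChar F).toMonoidHom)), (η⁻¹ * ((unramifiedTwist F (1 / 2) : QuasiChar F).toMonoidHom)⁻¹)] : Fin 3 → (Fˣ →* ℂˣ)) (revinv_A_inv η) (revinv_Y η) hNAA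

/-- **NAA(η) ⟸ NYA(η⁻¹)**: «no `Y(η⁻¹)` alone» ⇒ «no `A(η) = (ην½⁻¹, ην½, ην½⁻¹)` alone» (§2 with §1 `revinv_Y_inv`, `revinv_A`).
[cite: BernsteinZelevinsky1976, §2.23] [cite: Zelevinsky1980, §1.1, Ex. 3.2] -/
theorem noWeightAAlone_of_noWeightYAlone (hNYA : ∀ (r : SmoothIrrep (GL (Fin 3) F)), r.ρ.IsAdmissible → ∀ [FiniteDimensional ℂ (restrictUnipotentGL F (id : Fin 3 → Fin 3) r.ρ).Coinvariants],
      finrank ℂ ↥(⨅ m, Module.End.maxGenEigenspace (Representation.normalizedJacquetGL F (id : Fin 3 → Fin 3) r.ρ m) (((∏ a : Fin 3, ((![(η⁻¹ * ((unramifiedTwist F (1 / 2) : QuasiChar F).toMonoidHom)), (η⁻¹ * ((unramifiedTwist F (1 / 2) : QuasiChar F).toMonoidHom)⁻¹), (η⁻¹ * ((unramifiedTwist F (1 / 2) : QuasiChar F).toMonoidHom))] : Fin 3 → (Fˣ →* ℂˣ)) a).comp (Matrix.GeneralLinearGroup.det.comp (Pi.evalMonoidHom (fun a : Fin 3 =>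 GL {i : Fin 3 // (id : Fin 3 → Fin 3) i = a} F) a))) m : ℂˣ) : ℂ)) = 1 →
      (∀ ζ : (Π a : Fin 3, GL {i : Fin 3 // (id : Fin 3 → Fin 3) i = a} F) → ℂ, ζ ≠ (fun m : (Π a : Fin 3, GL {i : Fin 3 // (id : Fin 3 → Fin 3) i = a} F) => (((∏ a : Fin 3, ((![(η⁻¹ * ((unramifiedTwist F (1 / 2) : QuasiChar F).toMonoidHom)), (η⁻¹ * ((unramifiedTwist F (1 / 2) : QuasiChar F).toMonoidHom)⁻¹), (η⁻¹ * ((unramifiedTwist F (1 / 2) : QuasiChar F).toMonoidHom))] : Fin 3 → (Fˣ →* ℂˣ)) a).comp (Matrix.GeneralLinearGroup.det.comp (Pi.evalMonoidHom (fun a : Fin 3 => GL {i : Fin 3 // (id : Fin 3 → Fin 3) i = a} F) a))) m : ℂˣ) : ℂ)) → finrank ℂ ↥(⨅ m, Module.End.maxGenEigenspace (Representation.normalizedJacquetGL F (id : Fin 3 → Fin 3) r.ρ m) (ζ m)) = 0) → False) :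
    ∀ (r : SmoothIrrep (GL (Fin 3) F)), r.ρ.IsAdmissible → ∀ [FiniteDimensional ℂ (restrictUnipotentGL F (id : Fin 3 → Fin 3) r.ρ).Coinvariants],
      finrank ℂ ↥(⨅ m, Module.End.maxGenEigenspace (Representation.normalizedJacquetGL F (id : Fin 3 → Fin 3) r.ρ m) (((∏ a : Fin 3, ((![(η * ((unramifiedTwist F (1 / 2) : QuasiChar F).toMonoidHom)⁻¹), (η * ((unramifiedTwist F (1 / 2) : QuasiChar F).toMonoidHom)), (η * ((unramifiedTwist F (1 / 2) : QuasiChar F).toMonoidHom)⁻¹)] : Fin 3 → (Fˣ →* ℂˣ)) a).comp (Matrix.GeneralLinearGroup.det.comp (Pi.evalMonoidHom (fun a : Fin 3 => GL {i : Fin 3 // (id : Fin 3 → Fin 3) i = a} F) a))) m : ℂˣ) : ℂ)) = 1 →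
      (∀ ζ : (Π a : Fin 3, GL {i : Fin 3 // (id : Fin 3 → Fin 3) i = a} F) → ℂ, ζ ≠ (fun m : (Π a : Fin 3, GL {i : Fin 3 // (id : Fin 3 → Fin 3) i = a} F) => (((∏ a : Fin 3, ((![(η * ((unramifiedTwist F (1 / 2) : QuasiChar F).toMonoidHom)⁻¹), (η * ((unramifiedTwist F (1 / 2) : QuasiChar F).toMonoidHom)), (η * ((unramifiedTwist F (1 / 2) : QuasiChar F).toMonoidHom)⁻¹)] : Fin 3 → (Fˣ →* ℂˣ)) a).comp (Matrix.GeneralLinearGroup.det.comp (Pi.evalMonoidHom (fun a : Fin 3 => GL {i : Fin 3 // (id : Fin 3 → Fin 3) i = a} F) a))) m : ℂˣ) : ℂ)) → finrank ℂ ↥(⨅ m, Module.End.maxGenEigenspace (Representation.normalizedJacquetGL F (id : Fin 3 → Fin 3) r.ρ m) (ζ m)) = 0) → False :=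
  noWeightAlone_transport (![(η * ((unramifiedTwist F (1 / 2) : QuasiChar F).toMonoidHom)⁻¹), (η * ((unramifiedTwist F (1 / 2) : QuasiChar F).toMonoidHom)), (η * ((unramifiedTwist F (1 / 2) : QuasiChar F).toMonoidHom)⁻¹)] : Fin 3 → (Fˣ →* ℂˣ)) (![(η⁻¹ * ((unramifiedTwist F (1 / 2) : QuasiChar F).toMonoidHom)), (η⁻¹ * ((unramifiedTwist F (1 / 2) : QuasiChar F).toMonoidHom)⁻¹), (η⁻¹ * ((unramifiedTwist F (1 / 2) : QuasiChar F).toMonoidHom))] : Fin 3 → (Fˣ →* ℂˣ)) (revinv_Y_inv η) (revinv_A η) hNYA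

/-- **`∀ η` form: NAA for all `η` with open kernel ⇒ NYA for all `η` with open kernel** (the (C1″-NYA) socket `sig_K2E3GL3NestedHighNoWeightYAlone` body, per `F`), `η⁻¹` having open kernel
by ★ `ker_inv_eq_ker`. [cite: BernsteinZelevinsky1976, §2.23] [cite: Zelevinsky1980, §1.1, Ex. 3.2] -/
theorem forall_noWeightYAlone_of_forall_noWeightAAlone
    (hNAA : ∀ η : Fˣ →* ℂˣ, IsOpen ((η.ker : Subgroup Fˣ) : Set Fˣ) → ∀ (r : SmoothIrrep (GL (Fin 3) F)), r.ρ.IsAdmissible → ∀ [FiniteDimensional ℂ (restrictUnipotentGL F (id : Fin 3 → Fin 3) r.ρ).Coinvariants],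
      finrank ℂ ↥(⨅ m, Module.End.maxGenEigenspace (Representation.normalizedJacquetGL F (id : Fin 3 → Fin 3) r.ρ m) (((∏ a : Fin 3, ((![(η * ((unramifiedTwist F (1 / 2) : QuasiChar F).toMonoidHom)⁻¹), (η * ((unramifiedTwist F (1 / 2) : QuasiChar F).toMonoidHom)), (η * ((unramifiedTwist F (1 / 2) : QuasiChar F).toMonoidHom)⁻¹)] : Fin 3 → (Fˣ →* ℂˣ)) a).comp (Matrix.GeneralLinearGroup.det.comp (Pi.evalMonoidHom (fun a : Fin 3 => GL {i : Fin 3 // (id : Fin 3 → Fin 3) i = a} F) a))) m : ℂˣ) : ℂ)) = 1 →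
      (∀ ζ : (Π a : Fin 3, GL {i : Fin 3 // (id : Fin 3 → Fin 3) i = a} F) → ℂ, ζ ≠ (fun m : (Π a : Fin 3, GL {i : Fin 3 // (id : Fin 3 → Fin 3) i = a} F) => (((∏ a : Fin 3, ((![(η * ((unramifiedTwist F (1 / 2) : QuasiChar F).toMonoidHom)⁻¹), (η * ((unramifiedTwist F (1 / 2) : QuasiChar F).toMonoidHom)), (η * ((unramifiedTwist F (1 / 2) : QuasiChar F).toMonoidHom)⁻¹)] : Fin 3 → (Fˣ →* ℂˣ)) a).comp (Matrix.GeneralLinearGroup.det.comp (Pi.evalMonoidHom (fun a : Fin 3 => GL {i : Fin 3 // (id : Fin 3 → Fin 3) i = a} F) a))) m : ℂˣ) : ℂ)) → finrank ℂ ↥(⨅ m, Module.End.maxGenEigenspace (Representation.normalizedJacquetGL F (id : Fin 3 → Fin 3) r.ρ m) (ζ m)) = 0) → False) :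
    ∀ η : Fˣ →* ℂˣ, IsOpen ((η.ker : Subgroup Fˣ) : Set Fˣ) → ∀ (r : SmoothIrrep (GL (Fin 3) F)), r.ρ.IsAdmissible → ∀ [FiniteDimensional ℂ (restrictUnipotentGL F (id : Fin 3 → Fin 3) r.ρ).Coinvariants],
      finrank ℂ ↥(⨅ m, Module.End.maxGenEigenspace (Representation.normalizedJacquetGL F (id : Fin 3 → Fin 3) r.ρ m) (((∏ a : Fin 3, ((![(η * ((unramifiedTwist F (1 / 2) : QuasiChar F).toMonoidHom)), (η * ((unramifiedTwist F (1 / 2) : QuasiChar F).toMonoidHom)⁻¹), (η * ((unramifiedTwist F (1 / 2) : QuasiChar F).toMonoidHom))] : Fin 3 → (Fˣ →* ℂˣ)) a).comp (Matrix.GeneralLinearGroup.det.comp (Pi.evalMonoidHom (fun a : Fin 3 => GL {i : Fin 3 // (id : Fin 3 → Fin 3) i = a} F) a))) m : ℂˣ) : ℂ)) = 1 →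
      (∀ ζ : (Π a : Fin 3, GL {i : Fin 3 // (id : Fin 3 → Fin 3) i = a} F) → ℂ, ζ ≠ (fun m : (Π a : Fin 3, GL {i : Fin 3 // (id : Fin 3 → Fin 3) i = a} F) => (((∏ a : Fin 3, ((![(η * ((unramifiedTwist F (1 / 2) : QuasiChar F).toMonoidHom)), (η * ((unramifiedTwist F (1 / 2) : QuasiChar F).toMonoidHom)⁻¹), (η * ((unramifiedTwist F (1 / 2) : QuasiChar F).toMonoidHom))] : Fin 3 → (Fˣ →* ℂˣ)) a).comp (Matrix.GeneralLinearGroup.det.comp (Pi.evalMonoidHom (fun a : Fin 3 => GL {i : Fin 3 // (id : Fin 3 → Fin 3) i = a} F) a))) m : ℂˣ) : ℂ)) → finrank ℂ ↥(⨅ m, Module.End.maxGenEigenspace (Representation.normalizedJacquetGL F (id : Fin 3 → Fin 3) r.ρ m) (ζ m)) = 0) → False := fun η hη =>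
  noWeightYAlone_of_noWeightAAlone η (hNAA η⁻¹ (by rw [ker_inv_eq_ker]; exact hη))

/-- **`∀ η` form: NYA for all `η` with open kernel ⇒ NAA for all `η` with open kernel.** [cite: BernsteinZelevinsky1976, §2.23] [cite: Zelevinsky1980, §1.1, Ex. 3.2] -/
theorem forall_noWeightAAlone_of_forall_noWeightYAlone
    (hNYA : ∀ η : Fˣ →* ℂˣ, IsOpen ((η.ker : Subgroup Fˣ) : Set Fˣ) → ∀ (r : SmoothIrrep (GL (Fin 3) F)), r.ρ.IsAdmissible → ∀ [FiniteDimensional ℂ (restrictUnipotentGL F (id : Fin 3 → Fin 3) r.ρ).Coinvariants],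
      finrank ℂ ↥(⨅ m, Module.End.maxGenEigenspace (Representation.normalizedJacquetGL F (id : Fin 3 → Fin 3) r.ρ m) (((∏ a : Fin 3, ((![(η * ((unramifiedTwist F (1 / 2) : QuasiChar F).toMonoidHom)), (η * ((unramifiedTwist F (1 / 2) : QuasiChar F).toMonoidHom)⁻¹), (η * ((unramifiedTwist F (1 / 2) : QuasiChar F).toMonoidHom))] : Fin 3 → (Fˣ →* ℂˣ)) a).comp (Matrix.GeneralLinearGroup.det.comp (Pi.evalMonoidHom (fun a : Fin 3 => GL {i : Fin 3 // (id : Fin 3 → Fin 3) i = a} F) a))) m : ℂˣ) : ℂ)) = 1 →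
      (∀ ζ : (Π a : Fin 3, GL {i : Fin 3 // (id : Fin 3 → Fin 3) i = a} F) → ℂ, ζ ≠ (fun m : (Π a : Fin 3, GL {i : Fin 3 // (id : Fin 3 → Fin 3) i = a} F) => (((∏ a : Fin 3, ((![(η * ((unramifiedTwist F (1 / 2) : QuasiChar F).toMonoidHom)), (η * ((unramifiedTwist F (1 / 2) : QuasiChar F).toMonoidHom)⁻¹), (η * ((unramifiedTwist F (1 / 2) : QuasiChar F).toMonoidHom))] : Fin 3 → (Fˣ →* ℂˣ)) a).comp (Matrix.GeneralLinearGroup.det.comp (Pi.evalMonoidHom (fun a : Fin 3 => GL {i : Fin 3 // (id : Fin 3 → Fin 3) i = a} F) a))) m : ℂˣ) : ℂ)) → finrank ℂ ↥(⨅ m, Module.End.maxGenEigenspace (Representation.normalizedJacquetGL F (id : Fin 3 → Fin 3) r.ρ m) (ζ m)) = 0) → False) :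
    ∀ η : Fˣ →* ℂˣ, IsOpen ((η.ker : Subgroup Fˣ) : Set Fˣ) → ∀ (r : SmoothIrrep (GL (Fin 3) F)), r.ρ.IsAdmissible → ∀ [FiniteDimensional ℂ (restrictUnipotentGL F (id : Fin 3 → Fin 3) r.ρ).Coinvariants],
      finrank ℂ ↥(⨅ m, Module.End.maxGenEigenspace (Representation.normalizedJacquetGL F (id : Fin 3 → Fin 3) r.ρ m) (((∏ a : Fin 3, ((![(η * ((unramifiedTwist F (1 / 2) : QuasiChar F).toMonoidHom)⁻¹), (η * ((unramifiedTwist F (1 / 2) : QuasiChar F).toMonoidHom)), (η * ((unramifiedTwist F (1 / 2) : QuasiChar F).toMonoidHom)⁻¹)] : Fin 3 → (Fˣ →* ℂˣ)) a).comp (Matrix.GeneralLinearGroup.det.comp (Pi.evalMonoidHom (fun a : Fin 3 => GL {i : Fin 3 // (id : Fin 3 → Fin 3) i = a} F) a))) m : ℂˣ) : ℂ)) = 1 →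
      (∀ ζ : (Π a : Fin 3, GL {i : Fin 3 // (id : Fin 3 → Fin 3) i = a} F) → ℂ, ζ ≠ (fun m : (Π a : Fin 3, GL {i : Fin 3 // (id : Fin 3 → Fin 3) i = a} F) => (((∏ a : Fin 3, ((![(η * ((unramifiedTwist F (1 / 2) : QuasiChar F).toMonoidHom)⁻¹), (η * ((unramifiedTwist F (1 / 2) : QuasiChar F).toMonoidHom)), (η * ((unramifiedTwist F (1 / 2) : QuasiChar F).toMonoidHom)⁻¹)] : Fin 3 → (Fˣ →* ℂˣ)) a).comp (Matrix.GeneralLinearGroup.det.comp (Pi.evalMonoidHom (fun a : Fin 3 => GL {i : Fin 3 // (id : Fin 3 → Fin 3) i = a} F) a))) m : ℂˣ) : ℂ)) → finrank ℂ ↥(⨅ m, Module.End.maxGenEigenspace (Representation.normalizedJacquetGL F (id : Fin 3 → Fin 3) r.ρ m) (ζ m)) = 0) → False := fun η hη =>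
  noWeightAAlone_of_noWeightYAlone η (hNYA η⁻¹ (by rw [ker_inv_eq_ker]; exact hη))

end Summit.HodgeConjecture.HodgeConjecture.Cruxes.H413.K2E3GL3NoWeightAloneTransport

end
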